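import Summits.PneNP.PneNP.Theorems.KarlinRubinMonotoneBlindSwitch

/-!
# Route KarlinRubin, crux `MonotoneBlind` (stmt-PneNP-18027): AND of DNFs (depth 3, ∧-top) — the count

Stage B of the AC⁰ line (seat write-up `MonotoneBlind_AC0_announce.md`): the dual depth-3 case `f = ⋀_i D_i`, each
`D_i` a monotone DNF with NARROW terms (`≤ L` slots; wide terms are removed by the consumer). One clique-restriction
switching step w.r.t. a uniform `n₁`-subset `V₁` turns every `D_i` into an `r`-CNF inside `V₁` (`switch_cnf_of_good`),
so that `f` restricted is a narrow CNF, for which planting is harmless by the elementary CNF revival count.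

* `sum_powersetCard_flag_le` — choosing `A` uniformly = choosing `V₁ ⊇ A` first:
  `C(n-k, n₁-k) · Σ_{A} F(A) ≤ Σ_{V₁} Σ_{A ⊆ V₁} F(A)`;
* `narrowCnf_revival_count` — for a CNF with clauses of `≤ r` slots (depending on the input!), the pairs `(A ⊆ V₁, x)`
  with the CNF false at `x` and true after planting `A` number `≤ 2^{#slots} · r · C(n₁-2, k-2)`;
* `andDnf_flag_count` — **the count**: `C(n-k,n₁-k) · Σ_A #{x : f(plant A x)}` is at most
  `C(n₁,k) · m · (switching bound) + C(n,n₁) · C(n₁,k) · #{x : f x} + C(n,n₁) · 2^{#slots} · r · C(n₁-2,k-2)`.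

All `--supports stmt-PneNP-18027`; no definitions.
-/

set_option linter.dupNamespace false -- `Summit.PneNP.PneNP.…`: summit = sub-problem (D-0017)

namespace Summit.PneNP.PneNP.Theorems

open Finset
open Literature.Computability.Complexity
open Literature.Probability.RandomGraphs.PlantedClique

variable {n : ℕ}

/-! ### Choosing the planted set through a random sub-universe -/

/-- **Flag count.** For `k ≤ n₁`: every `k`-set `A` lies in at least `C(n-k, n₁-k)` of the `n₁`-subsets of `Fin n`, so
`C(n-k, n₁-k) · Σ_A F(A) ≤ Σ_{V₁} Σ_{A ⊆ V₁} F(A)`. [folklore] -/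
theorem sum_powersetCard_flag_le (k n₁ : ℕ) (hk : k ≤ n₁) (F : Finset (Fin n) → ℕ) :
    (n - k).choose (n₁ - k) * ∑ A ∈ powersetCard k (univ : Finset (Fin n)), F A ≤
      ∑ V₁ ∈ powersetCard n₁ (univ : Finset (Fin n)), ∑ A ∈ powersetCard k V₁, F A := by
  classical
  -- rewrite the right-hand side as a sum over `A` of `F A · #{V₁ ⊇ A}`
  have hrhs : ∑ V₁ ∈ powersetCard n₁ (univ : Finset (Fin n)), ∑ A ∈ powersetCard k V₁, F A =
      ∑ A ∈ powersetCard k (univ : Finset (Fin n)),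
        #((powersetCard n₁ (univ : Finset (Fin n))).filter fun V₁ => A ⊆ V₁) * F A := by
    have h1 : ∀ V₁ ∈ powersetCard n₁ (univ : Finset (Fin n)), ∑ A ∈ powersetCard k V₁, F A =
        ∑ A ∈ powersetCard k (univ : Finset (Fin n)), if A ⊆ V₁ then F A else 0 := by
      intro V₁ _
      rw [← sum_filter]
      congr 1
      ext A
      simp only [mem_powersetCard, mem_filter, subset_univ, true_and]
      tauto
    rw [sum_congr rfl h1, sum_comm]
    refine sum_congr rfl fun A _ => ?_
    rw [← sum_filter, sum_const, smul_eq_mul]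
  rw [hrhs, mul_sum]
  refine sum_le_sum fun A hA => Nat.mul_le_mul_right _ ?_
  rw [mem_powersetCard] at hA
  -- the injection `W ↦ W ∪ A` from the `(n₁-k)`-subsets of the complement
  calc (n - k).choose (n₁ - k) = #(powersetCard (n₁ - k) ((univ : Finset (Fin n)) \ A)) := by
        rw [card_powersetCard, card_sdiff_of_subset (subset_univ _), card_univ, Fintype.card_fin, hA.2]
    _ ≤ #((powersetCard n₁ (univ : Finset (Fin n))).filter fun V₁ => A ⊆ V₁) := by
        refine card_le_card_of_injOn (fun W => W ∪ A) (fun W hW => ?_) ?_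
        · rw [mem_coe, mem_powersetCard] at hW
          rw [mem_coe, mem_filter, mem_powersetCard]
          refine ⟨⟨subset_univ _, ?_⟩, subset_union_right⟩
          have hdisj : Disjoint W A := by
            rw [Finset.disjoint_left]
            intro v hvW hvA
            have := hW.1 hvW
            rw [mem_sdiff] at this
            exact this.2 hvA
          rw [card_union_of_disjoint hdisj, hW.2, hA.2]
          omega
        · intro W hW W' hW' h
          rw [mem_coe, mem_powersetCard] at hW hW'
          have hdW : Disjoint W A := Finset.disjoint_left.2 fun v hvW hvA => (mem_sdiff.1 (hW.1 hvW)).2 hvA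
          have hdW' : Disjoint W' A := Finset.disjoint_left.2 fun v hvW hvA => (mem_sdiff.1 (hW'.1 hvW)).2 hvA
          simp only at h
          rw [← union_sdiff_cancel_right hdW, ← union_sdiff_cancel_right hdW', h]

/-! ### Revival of a narrow CNF by planting -/

open Classical in
/-- **Revival count for narrow CNFs.** Let `𝓒 x` be, for every input `x`, a clause family whose clauses have `≤ r`
slots. The pairs `(A, x)` with `A` a `k`-subset of `V₁`, the CNF of `𝓒 x` false at `x` and true after planting `A`,
number at most `2^{#slots} · r · C(#V₁ - 2, k - 2)`: a dead clause of `x` must receive a planted slot, i.e. `A` contains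
both endpoints of one of its `≤ r` slots. [folklore] -/
theorem narrowCnf_revival_count (V₁ : Finset (Fin n)) (k r : ℕ)
    (𝓒 : EdgeVec n → Finset (Finset (⊤ : SimpleGraph (Fin n)).edgeSet)) (h𝓒 : ∀ x, ∀ S ∈ 𝓒 x, #S ≤ r) :
    ∑ A ∈ powersetCard k V₁, #(univ.filter fun x : EdgeVec n =>
        (∀ S ∈ 𝓒 x, ∃ e ∈ S, plant A x e = true) ∧ ¬ ∀ S ∈ 𝓒 x, ∃ e ∈ S, x e = true) ≤
      2 ^ Fintype.card (⊤ : SimpleGraph (Fin n)).edgeSet * (r * (#V₁ - 2).choose (k - 2)) := by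
  have hswap : ∑ A ∈ powersetCard k V₁, #(univ.filter fun x : EdgeVec n =>
        (∀ S ∈ 𝓒 x, ∃ e ∈ S, plant A x e = true) ∧ ¬ ∀ S ∈ 𝓒 x, ∃ e ∈ S, x e = true) =
      ∑ x : EdgeVec n, #((powersetCard k V₁).filter fun A =>
        (∀ S ∈ 𝓒 x, ∃ e ∈ S, plant A x e = true) ∧ ¬ ∀ S ∈ 𝓒 x, ∃ e ∈ S, x e = true) := by
    simp only [card_filter]
    rw [Finset.sum_comm]
    refine Finset.sum_congr rfl fun x _ => Finset.sum_congr rfl fun A _ => ?_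
    convert rfl
  have hcard : (2 : ℕ) ^ Fintype.card (⊤ : SimpleGraph (Fin n)).edgeSet = #(univ : Finset (EdgeVec n)) := by
    simp [EdgeVec]
  rw [hswap, hcard, card_eq_sum_ones, sum_mul, one_mul]
  refine sum_le_sum fun x _ => ?_
  by_cases hdead : ∃ S ∈ 𝓒 x, ∀ e ∈ S, x e = false
  · obtain ⟨S, hS, hSx⟩ := hdead
    -- `A` must contain both endpoints of a slot of the dead clause `S`
    calc #((powersetCard k V₁).filter fun A =>
          (∀ S ∈ 𝓒 x, ∃ e ∈ S, plant A x e = true) ∧ ¬ ∀ S ∈ 𝓒 x, ∃ e ∈ S, x e = true)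
        ≤ #(S.biUnion fun e => (powersetCard k V₁).filter fun A =>
            (univ.filter fun v : Fin n => v ∈ (e : Sym2 (Fin n))) ⊆ A) := by
          refine card_le_card fun A hA => ?_
          rw [mem_filter] at hA
          obtain ⟨hA, hrev, -⟩ := hA
          obtain ⟨e, he, hpe⟩ := hrev S hS
          rw [plant_apply_eq_true_iff, hSx e he] at hpe
          rcases hpe with h | h
          · exact absurd h Bool.false_ne_true
          · rw [mem_biUnion]
            refine ⟨e, he, mem_filter.2 ⟨hA, fun v hv => ?_⟩⟩
            rw [mem_filter] at hv
            exact h v hv.2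
      _ ≤ ∑ e ∈ S, #((powersetCard k V₁).filter fun A =>
            (univ.filter fun v : Fin n => v ∈ (e : Sym2 (Fin n))) ⊆ A) := card_biUnion_le
      _ ≤ ∑ _e ∈ S, (#V₁ - 2).choose (k - 2) :=
          sum_le_sum fun e _ => switch_card_supersets_le V₁ k 2 _ (card_filter_mem_edge e).ge
      _ = #S * (#V₁ - 2).choose (k - 2) := by rw [sum_const, smul_eq_mul]
      _ ≤ r * (#V₁ - 2).choose (k - 2) := Nat.mul_le_mul_right _ (h𝓒 x S hS)
  · rw [Finset.card_eq_zero.2]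
    · exact Nat.zero_le _
    rw [filter_eq_empty_iff]
    rintro A - ⟨-, hno⟩
    refine hno fun S hS => ?_
    by_contra hS'
    refine hdead ⟨S, hS, fun e he => ?_⟩
    cases hxe : x e
    · rfl
    · exact absurd ⟨e, he, hxe⟩ hS'

/-! ### The count for an AND of narrow DNFs -/

open Classical in
/-- **Flag count for an AND of narrow DNFs.** Let `f x = ∀ i, ∃ T ∈ 𝓓 i, T ⊆ x` with `#(𝓓 i) ≤ M` and every term of
`≤ L` slots; `0 < v₀`, `r = C(v₀-1,2)`, `k ≤ n₁`. Then `C(n-k, n₁-k) · Σ_{A} #{x : f (plant A x)}` is at most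
`C(n₁,k) · m · SW + C(n,n₁) · C(n₁,k) · #{x : f x} + C(n,n₁) · 2^{#slots} · r · C(n₁-2, k-2)`, where `SW` is the bound of
the switching lemma (`switch_bad_count`, for `V = univ`). [cite: Beame1994, §3] -/
theorem andDnf_flag_count (k n₁ L v₀ : ℕ) (hk : k ≤ n₁) (hv₀ : 0 < v₀) {m M : ℕ}
    (𝓓 : Fin m → Finset (Finset (⊤ : SimpleGraph (Fin n)).edgeSet)) (hM : ∀ i, #(𝓓 i) ≤ M)
    (hL : ∀ i, ∀ T ∈ 𝓓 i, #T ≤ L) :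
    (n - k).choose (n₁ - k) * ∑ A ∈ powersetCard k (univ : Finset (Fin n)),
        #(univ.filter fun x : EdgeVec n => ∀ i, ∃ T ∈ 𝓓 i, ∀ e ∈ T, plant A x e = true) ≤
      n₁.choose k * (m * (2 ^ Fintype.card (⊤ : SimpleGraph (Fin n)).edgeSet * (n - v₀).choose (n₁ - v₀) *
        (2 ^ ((v₀ - 1).choose 2 + (v₀ - 1).choose 2) *
            (2 * (L + 1) ^ (2 * (v₀ - 1).choose 2)) ^ ((v₀ - 1).choose 2 + 1) + M * (2 * L).choose v₀))) +
      n.choose n₁ * (n₁.choose k * #(univ.filter fun x : EdgeVec n => ∀ i, ∃ T ∈ 𝓓 i, ∀ e ∈ T, x e = true)) +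
      n.choose n₁ * (2 ^ Fintype.card (⊤ : SimpleGraph (Fin n)).edgeSet *
        ((v₀ - 1).choose 2 * (n₁ - 2).choose (k - 2))) := by
  set r := (v₀ - 1).choose 2 with hr
  set N := Fintype.card (⊤ : SimpleGraph (Fin n)).edgeSet with hN
  set SW := 2 ^ N * (n - v₀).choose (n₁ - v₀) *
      (2 ^ (r + r) * (2 * (L + 1) ^ (2 * r)) ^ (r + 1) + M * (2 * L).choose v₀) with hSW
  set f : EdgeVec n → Prop := fun x => ∀ i, ∃ T ∈ 𝓓 i, ∀ e ∈ T, x e = true with hf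
  -- the bad event of the switching step (dual form: runs on the complemented input)
  set bad : Finset (Fin n) → EdgeVec n → Prop := fun V₁ x => ∃ i, ∃ z : EdgeVec n,
      v₀ ≤ #(univ.filter fun v : Fin n =>
        ∃ e ∈ (swRun V₁ (fun e => !x e) z (𝓓 i).toList ∅).2, v ∈ (e : Sym2 (Fin n))) with hbad
  -- (1) the switching lemma, summed over the `m` DNFs
  have h1 : ∑ V₁ ∈ powersetCard n₁ (univ : Finset (Fin n)), #(univ.filter fun x : EdgeVec n => bad V₁ x) ≤
      m * SW := by
    have hone : ∀ i, ∑ V₁ ∈ powersetCard n₁ (univ : Finset (Fin n)), #(univ.filter fun x : EdgeVec n =>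
        ∃ z : EdgeVec n, v₀ ≤ #(univ.filter fun v : Fin n =>
          ∃ e ∈ (swRun V₁ (fun e => !x e) z (𝓓 i).toList ∅).2, v ∈ (e : Sym2 (Fin n)))) ≤ SW := by
      intro i
      have h := switch_bad_count (univ : Finset (Fin n)) n₁ L v₀ hv₀ (𝓓 i).toList
        (fun S hS => hL i S (Finset.mem_toList.1 hS))
      rw [card_univ, Fintype.card_fin, Finset.length_toList] at h
      refine le_trans (le_of_eq (sum_congr rfl fun V₁ _ => switch_bad_count_compl V₁ (𝓓 i).toList v₀)) ?_
      refine h.trans ?_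
      rw [hSW, hr, hN]
      gcongr
      exact hM i
    calc ∑ V₁ ∈ powersetCard n₁ (univ : Finset (Fin n)), #(univ.filter fun x : EdgeVec n => bad V₁ x)
        ≤ ∑ V₁ ∈ powersetCard n₁ (univ : Finset (Fin n)), ∑ i : Fin m, #(univ.filter fun x : EdgeVec n =>
            ∃ z : EdgeVec n, v₀ ≤ #(univ.filter fun v : Fin n =>
              ∃ e ∈ (swRun V₁ (fun e => !x e) z (𝓓 i).toList ∅).2, v ∈ (e : Sym2 (Fin n)))) := by
          refine sum_le_sum fun V₁ _ => ?_
          refine le_trans (card_le_card fun x hx => ?_) card_biUnion_le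
          rw [mem_filter] at hx
          obtain ⟨-, i, hi⟩ := hx
          rw [mem_biUnion]
          exact ⟨i, mem_univ _, mem_filter.2 ⟨mem_univ _, hi⟩⟩
      _ = ∑ i : Fin m, ∑ V₁ ∈ powersetCard n₁ (univ : Finset (Fin n)), #(univ.filter fun x : EdgeVec n =>
            ∃ z : EdgeVec n, v₀ ≤ #(univ.filter fun v : Fin n =>
              ∃ e ∈ (swRun V₁ (fun e => !x e) z (𝓓 i).toList ∅).2, v ∈ (e : Sym2 (Fin n)))) := sum_comm
      _ ≤ ∑ _i : Fin m, SW := sum_le_sum fun i _ => hone i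
      _ = m * SW := by rw [sum_const, smul_eq_mul, card_univ, Fintype.card_fin]
  -- (2) on the good event, `f` restricted is a narrow CNF inside `V₁`
  have h2 : ∀ V₁ x, ¬ bad V₁ x → ∃ 𝓒 : Finset (Finset (⊤ : SimpleGraph (Fin n)).edgeSet),
      (∀ S ∈ 𝓒, #S ≤ r) ∧
      ∀ w : EdgeVec n, (∀ e : (⊤ : SimpleGraph (Fin n)).edgeSet, (¬ ∀ v ∈ (e : Sym2 (Fin n)), v ∈ V₁) → w e = x e) →
        (f w ↔ ∀ S ∈ 𝓒, ∃ e ∈ S, w e = true) := by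
    intro V₁ x hgood
    have hgood' : ∀ i, ∀ z : EdgeVec n, #(univ.filter fun v : Fin n =>
        ∃ e ∈ (swRun V₁ (fun e => !x e) z (𝓓 i).toList ∅).2, v ∈ (e : Sym2 (Fin n))) < v₀ := by
      intro i z
      by_contra hge
      exact hgood ⟨i, z, not_lt.1 hge⟩
    choose 𝓒 _ h𝓒r h𝓒iff using fun i => switch_cnf_of_good V₁ x (𝓓 i).toList v₀ (hgood' i)
    refine ⟨univ.biUnion 𝓒, fun S hS => ?_, fun w hw => ?_⟩
    · rw [mem_biUnion] at hS
      obtain ⟨i, -, hS⟩ := hS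
      exact (h𝓒r i S hS).1
    · rw [hf]
      simp only [mem_biUnion, mem_univ, true_and]
      constructor
      · rintro hfw S ⟨i, hS⟩
        have := (h𝓒iff i w hw).1 ?_
        · exact this S hS
        · obtain ⟨T, hT, hTw⟩ := hfw i
          exact ⟨T, Finset.mem_toList.2 hT, hTw⟩
      · intro hall i
        obtain ⟨T, hT, hTw⟩ := (h𝓒iff i w hw).2 fun S hS => hall S ⟨i, hS⟩
        exact ⟨T, Finset.mem_toList.1 hT, hTw⟩
  -- a canonical narrow CNF for every `(V₁, x)` (junk `∅` on the bad event)
  have h2' : ∀ V₁ x, ∃ 𝓒 : Finset (Finset (⊤ : SimpleGraph (Fin n)).edgeSet), (∀ S ∈ 𝓒, #S ≤ r) ∧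
      (¬ bad V₁ x → ∀ w : EdgeVec n,
        (∀ e : (⊤ : SimpleGraph (Fin n)).edgeSet, (¬ ∀ v ∈ (e : Sym2 (Fin n)), v ∈ V₁) → w e = x e) →
          (f w ↔ ∀ S ∈ 𝓒, ∃ e ∈ S, w e = true)) := by
    intro V₁ x
    by_cases hb : bad V₁ x
    · exact ⟨∅, by simp, fun h => absurd hb h⟩
    · obtain ⟨𝓒, h𝓒r, h𝓒⟩ := h2 V₁ x hb
      exact ⟨𝓒, h𝓒r, fun _ => h𝓒⟩
  choose 𝓒 h𝓒r h𝓒iff using h2'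
  -- (3) per `(V₁, A)`: split the planted acceptances
  have h3 : ∀ V₁ ∈ powersetCard n₁ (univ : Finset (Fin n)), ∀ A ∈ powersetCard k V₁,
      #(univ.filter fun x : EdgeVec n => f (plant A x)) ≤
        #(univ.filter fun x : EdgeVec n => bad V₁ x) + #(univ.filter fun x : EdgeVec n => f x) +
        #(univ.filter fun x : EdgeVec n =>
          (∀ S ∈ 𝓒 V₁ x, ∃ e ∈ S, plant A x e = true) ∧ ¬ ∀ S ∈ 𝓒 V₁ x, ∃ e ∈ S, x e = true) := by
    intro V₁ _ A hA
    rw [mem_powersetCard] at hA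
    refine le_trans (card_le_card fun x hx => ?_)
      ((card_union_le _ _).trans (Nat.add_le_add_right (card_union_le _ _) _))
    rw [mem_filter] at hx
    obtain ⟨-, hfx⟩ := hx
    rw [mem_union, mem_union, mem_filter, mem_filter, mem_filter]
    by_cases hb : bad V₁ x
    · exact Or.inl (Or.inl ⟨mem_univ _, hb⟩)
    by_cases hfx' : f x
    · exact Or.inl (Or.inr ⟨mem_univ _, hfx'⟩)
    refine Or.inr ⟨mem_univ _, ?_, ?_⟩
    · refine (h𝓒iff V₁ x hb (plant A x) fun e he => ?_).1 hfx
      exact plant_apply_of_not_inside A x e fun heA => he fun v hv => hA.1 (heA v hv)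
    · exact fun hcnf => hfx' ((h𝓒iff V₁ x hb x fun _ _ => rfl).2 hcnf)
  -- (4) assembly
  calc (n - k).choose (n₁ - k) * ∑ A ∈ powersetCard k (univ : Finset (Fin n)),
        #(univ.filter fun x : EdgeVec n => f (plant A x))
      ≤ ∑ V₁ ∈ powersetCard n₁ (univ : Finset (Fin n)), ∑ A ∈ powersetCard k V₁,
          #(univ.filter fun x : EdgeVec n => f (plant A x)) :=
        sum_powersetCard_flag_le k n₁ hk fun A => #(univ.filter fun x : EdgeVec n => f (plant A x))
    _ ≤ ∑ V₁ ∈ powersetCard n₁ (univ : Finset (Fin n)), ∑ A ∈ powersetCard k V₁,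
          (#(univ.filter fun x : EdgeVec n => bad V₁ x) + #(univ.filter fun x : EdgeVec n => f x) +
          #(univ.filter fun x : EdgeVec n =>
            (∀ S ∈ 𝓒 V₁ x, ∃ e ∈ S, plant A x e = true) ∧ ¬ ∀ S ∈ 𝓒 V₁ x, ∃ e ∈ S, x e = true)) :=
        sum_le_sum fun V₁ hV₁ => sum_le_sum fun A hA => h3 V₁ hV₁ A hA
    _ = ∑ V₁ ∈ powersetCard n₁ (univ : Finset (Fin n)),
          (#(powersetCard k V₁) * #(univ.filter fun x : EdgeVec n => bad V₁ x) +
           #(powersetCard k V₁) * #(univ.filter fun x : EdgeVec n => f x) +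
           ∑ A ∈ powersetCard k V₁, #(univ.filter fun x : EdgeVec n =>
            (∀ S ∈ 𝓒 V₁ x, ∃ e ∈ S, plant A x e = true) ∧ ¬ ∀ S ∈ 𝓒 V₁ x, ∃ e ∈ S, x e = true)) := by
        refine sum_congr rfl fun V₁ _ => ?_
        rw [sum_add_distrib, sum_add_distrib, sum_const, sum_const, smul_eq_mul, smul_eq_mul]
    _ ≤ ∑ V₁ ∈ powersetCard n₁ (univ : Finset (Fin n)),
          (n₁.choose k * #(univ.filter fun x : EdgeVec n => bad V₁ x) +
           n₁.choose k * #(univ.filter fun x : EdgeVec n => f x) +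
           2 ^ N * (r * (n₁ - 2).choose (k - 2))) := by
        refine sum_le_sum fun V₁ hV₁ => ?_
        rw [mem_powersetCard] at hV₁
        have hPk : #(powersetCard k V₁) = n₁.choose k := by rw [card_powersetCard, hV₁.2]
        rw [hPk]
        refine Nat.add_le_add_left ?_ _
        have h := narrowCnf_revival_count V₁ k r (𝓒 V₁) (fun x S hS => h𝓒r V₁ x S hS)
        rw [hV₁.2] at h
        exact h
    _ = n₁.choose k * ∑ V₁ ∈ powersetCard n₁ (univ : Finset (Fin n)), #(univ.filter fun x : EdgeVec n => bad V₁ x) +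
          n.choose n₁ * (n₁.choose k * #(univ.filter fun x : EdgeVec n => f x)) +
          n.choose n₁ * (2 ^ N * (r * (n₁ - 2).choose (k - 2))) := by
        rw [sum_add_distrib, sum_add_distrib, ← mul_sum, sum_const, sum_const, smul_eq_mul, smul_eq_mul,
          card_powersetCard, card_univ, Fintype.card_fin]
    _ ≤ n₁.choose k * (m * SW) +
          n.choose n₁ * (n₁.choose k * #(univ.filter fun x : EdgeVec n => f x)) +
          n.choose n₁ * (2 ^ N * (r * (n₁ - 2).choose (k - 2))) := by
        gcongr

/-- Registered stub `stub_pi3Count` of the AC⁰ line, stage B (the flag double count). [folklore] -/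
theorem stub_pi3Count :
    ∀ (n k n₁ : ℕ), k ≤ n₁ → ∀ F : Finset (Fin n) → ℕ,
      (n - k).choose (n₁ - k) * ∑ A ∈ Finset.powersetCard k (Finset.univ : Finset (Fin n)), F A ≤
        ∑ V₁ ∈ Finset.powersetCard n₁ (Finset.univ : Finset (Fin n)), ∑ A ∈ Finset.powersetCard k V₁, F A :=
  fun _ k n₁ hk F => sum_powersetCard_flag_le k n₁ hk F

end Summit.PneNP.PneNP.Theorems
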